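import Summits.Ventures.PercRepro.GenQChargeBounds

/-!
# PercRepro — the bases inside `B₀ ∪ {x, y}` remove two points of `C_x ∪ C_y`; the two layers with bounds
(night-4, gen 3)

Two general-`q` tools for the type-`2` windows of the diagonal rows through the charging form (`GenQChargeTwo.lean`):

* `eRk_union_fc_add_two_le`, `nb_pair_le_choose` — for the fundamental circuits `C_x`, `C_y` of two points of `G ∖ B₀`,
  `r(C_x ∪ C_y) ≤ #(C_x ∪ C_y) − 2` (submodularity; `C_x ∩ C_y ⊆ B₀`), so a basis inside `B₀ ∪ {x, y}` omits two points
  of `C_x ∪ C_y`: `nb(B₀ ∪ {x, y}) ≤ C(#(C_x ∪ C_y), 2)` — sharper than `nb_pair_le`;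
* `charge_ge_of_bounds` — the charge of `B₀` from the singletons and pairs of `K = G ∖ B₀`, given per-element bounds
  `σ₃` (singletons with `#C_x = 3`), `σ₄` (the other singletons) and `τ` (every pair):
  `#K₃·σ₃ + (#K − #K₃)·σ₄ + C(#K, 2)·τ ≤ charge(B₀)`.
-/

namespace PercRepro.GenQ

open Finset ThmH PerFlat SixFour ThmN

variable {α : Type*} [DecidableEq α] {M : Matroid α} [M.Finite]

/-! ## The bases inside `B₀ ∪ {x, y}` remove two points of `C_x ∪ C_y` -/

omit [DecidableEq α] [M.Finite] in
/-- The rank of a finset is a natural number. -/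
theorem exists_nat_eRk (B : Finset α) : ∃ r : ℕ, M.eRk (B : Set α) = (r : ℕ∞) := by
  have h := M.eRk_le_encard (B : Set α)
  rw [Set.encard_coe_eq_coe_finsetCard] at h
  obtain ⟨r, hr⟩ := ENat.ne_top_iff_exists.1 (ne_top_of_le_ne_top (ENat.coe_ne_top _) h)
  exact ⟨r, hr.symm⟩

/-- **`r(C_x ∪ C_y) + 2 ≤ #(C_x ∪ C_y)`** for the fundamental circuits of two points `x ≠ y` of `G ∖ B₀`
(submodularity: `C_x ∩ C_y ⊆ B₀` is independent). -/
theorem eRk_union_fc_add_two_le {G B₀ : Finset α} {q : ℕ} (hG : G ⊆ gr M)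
    (hrG : M.eRk (G : Set α) = (q : ℕ∞)) (hB : B₀ ∈ basesOf M G q) {x y : α} (hx : x ∈ G) (hxB : x ∉ B₀)
    (hy : y ∈ G) (hyB : y ∉ B₀) (hxy : x ≠ y) :
    M.eRk ((fc M x B₀ ∪ fc M y B₀ : Finset α) : Set α) + 2 ≤ ((fc M x B₀ ∪ fc M y B₀).card : ℕ∞) := by
  have hI := indep_of_mem_basesOf hB
  have hCx : M.IsCircuit ((fc M x B₀ : Finset α) : Set α) :=
    isCircuit_fc hI (mem_closure_of_mem_basesOf hG hrG hB hx) hxB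
  have hCy : M.IsCircuit ((fc M y B₀ : Finset α) : Set α) :=
    isCircuit_fc hI (mem_closure_of_mem_basesOf hG hrG hB hy) hyB
  have hint : fc M x B₀ ∩ fc M y B₀ ⊆ B₀ := by
    intro e he
    rw [Finset.mem_inter] at he
    rcases Finset.mem_insert.1 (fc_subset_insert x B₀ he.1) with hex | heB
    · exfalso
      rcases Finset.mem_insert.1 (fc_subset_insert y B₀ he.2) with hey | heB'
      · exact hxy (hex.symm.trans hey)
      · exact hxB (hex ▸ heB')
    · exact heB
  have hsub := M.eRk_inter_add_eRk_union_le ((fc M x B₀ : Finset α) : Set α) ((fc M y B₀ : Finset α) : Set α)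
  rw [← Finset.coe_inter, ← Finset.coe_union, (hI.subset (Finset.coe_subset.2 hint)).eRk_eq_encard,
    Set.encard_coe_eq_coe_finsetCard] at hsub
  have hrx := hCx.eRk_add_one_eq
  have hry := hCy.eRk_add_one_eq
  rw [Set.encard_coe_eq_coe_finsetCard] at hrx hry
  obtain ⟨rx, hrx'⟩ := exists_nat_eRk (M := M) (fc M x B₀)
  obtain ⟨ry, hry'⟩ := exists_nat_eRk (M := M) (fc M y B₀)
  obtain ⟨ru, hru'⟩ := exists_nat_eRk (M := M) (fc M x B₀ ∪ fc M y B₀)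
  rw [hrx'] at hrx hsub
  rw [hry'] at hry hsub
  rw [hru'] at hsub ⊢
  have h1 : rx + 1 = (fc M x B₀).card := by exact_mod_cast hrx
  have h2 : ry + 1 = (fc M y B₀).card := by exact_mod_cast hry
  have h3 : (fc M x B₀ ∩ fc M y B₀).card + ru ≤ rx + ry := by exact_mod_cast hsub
  have h4 := Finset.card_union_add_card_inter (fc M x B₀) (fc M y B₀)
  exact_mod_cast (by omega : ru + 2 ≤ (fc M x B₀ ∪ fc M y B₀).card)

/-- **`nb(B₀ ∪ {x, y}) ≤ C(#(C_x ∪ C_y), 2)`**: a basis inside `B₀ ∪ {x, y}` omits two points, both in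
`C_x ∪ C_y` (else it contains all but one point of a set of nullity `≥ 2`). -/
theorem nb_pair_le_choose {G B₀ : Finset α} {q : ℕ} (hG : G ⊆ gr M) (hrG : M.eRk (G : Set α) = (q : ℕ∞))
    (hB : B₀ ∈ basesOf M G q) {x y : α} (hx : x ∈ G) (hxB : x ∉ B₀) (hy : y ∈ G) (hyB : y ∉ B₀) (hxy : x ≠ y) :
    nb M G (insert x (insert y B₀)) q ≤ (fc M x B₀ ∪ fc M y B₀).card.choose 2 := by
  set S := insert x (insert y B₀) with hSdef
  set U := fc M x B₀ ∪ fc M y B₀ with hUdef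
  obtain ⟨_, _, hc⟩ := mem_basesOf.1 hB
  have hUS : U ⊆ S := Finset.union_subset
    ((fc_subset_insert x B₀).trans (Finset.insert_subset_insert x (Finset.subset_insert y B₀)))
    ((fc_subset_insert y B₀).trans (Finset.subset_insert x _))
  have hxS : x ∉ insert y B₀ := fun h' => by
    rcases Finset.mem_insert.1 h' with h'' | h''
    · exact hxy h''
    · exact hxB h''
  have hcardS : S.card = q + 2 := by
    rw [hSdef, Finset.card_insert_of_notMem hxS, Finset.card_insert_of_notMem hyB, hc]
  have hrU := eRk_union_fc_add_two_le hG hrG hB hx hxB hy hyB hxy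
  rw [← hUdef] at hrU
  obtain ⟨r, hr⟩ := exists_nat_eRk (M := M) U
  rw [hr] at hrU
  have hrU' : r + 2 ≤ U.card := by exact_mod_cast hrU
  -- an independent `q`-subset `T ⊆ S` omits two points of `U`
  have key : ∀ T ∈ (basesOf M G q).filter (fun T => T ⊆ S), S \ T ⊆ U := by
    intro T hT
    rw [Finset.mem_filter] at hT
    obtain ⟨hTb, hTS⟩ := hT
    obtain ⟨_, _, hTc⟩ := mem_basesOf.1 hTb
    have hTI := indep_of_mem_basesOf hTb
    intro p hp
    by_contra hpU
    have hcard2 : (S \ T).card = 2 := by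
      rw [Finset.card_sdiff_of_subset hTS, hcardS, hTc]
      omega
    have hp' : ((S \ T).erase p).card = 1 := by rw [Finset.card_erase_of_mem hp, hcard2]
    obtain ⟨p', hp'eq⟩ := Finset.card_eq_one.1 hp'
    have hsub : U.erase p' ⊆ T := by
      intro e he
      rw [Finset.mem_erase] at he
      by_contra heT
      have heST : e ∈ S \ T := Finset.mem_sdiff.2 ⟨hUS he.2, heT⟩
      by_cases hep : e = p
      · exact hpU (hep ▸ he.2)
      · have : e ∈ (S \ T).erase p := Finset.mem_erase.2 ⟨hep, heST⟩
        rw [hp'eq, Finset.mem_singleton] at this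
        exact he.1 this
    have hdep : ¬ M.Indep ((U.erase p' : Finset α) : Set α) := by
      intro hind
      have h1 := hind.eRk_eq_encard
      rw [Set.encard_coe_eq_coe_finsetCard] at h1
      have h2 : M.eRk ((U.erase p' : Finset α) : Set α) ≤ M.eRk (U : Set α) :=
        M.eRk_mono (by exact_mod_cast Finset.erase_subset p' U)
      rw [h1, hr] at h2
      have h2' : (U.erase p').card ≤ r := by exact_mod_cast h2
      have hcardE : U.card ≤ (U.erase p').card + 1 := by
        by_cases hp'U : p' ∈ U
        · have := Finset.card_pos.2 ⟨p', hp'U⟩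
          rw [Finset.card_erase_of_mem hp'U]
          omega
        · rw [Finset.erase_eq_of_notMem hp'U]
          omega
      omega
    exact hdep (hTI.subset (Finset.coe_subset.2 hsub))
  unfold nb
  calc ((basesOf M G q).filter (fun T => T ⊆ S)).card ≤ (U.powersetCard 2).card := by
        apply Finset.card_le_card_of_injOn (fun T => S \ T)
        · intro T hT
          rw [Finset.mem_coe] at hT
          rw [Finset.mem_coe, Finset.mem_powersetCard]
          refine ⟨key T hT, ?_⟩
          rw [Finset.mem_filter] at hT
          obtain ⟨_, _, hTc⟩ := mem_basesOf.1 hT.1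
          rw [Finset.card_sdiff_of_subset hT.2, hcardS, hTc]
          omega
        · intro T₁ hT₁ T₂ hT₂ heq
          rw [Finset.mem_coe, Finset.mem_filter] at hT₁ hT₂
          simp only at heq
          rw [← Finset.sdiff_sdiff_eq_self hT₁.2, heq, Finset.sdiff_sdiff_eq_self hT₂.2]
    _ = U.card.choose 2 := Finset.card_powersetCard 2 U

/-! ## The charge from the two layers, given per-element bounds (every `q`) -/

/-- **The charge of `B₀` from the two layers**, given a bound `σ₃` for the singletons with `#C_x = 3`, `σ₄` for the
other singletons and a bound `τ P` for each pair `P`: `#K₃·σ₃ + (#K − #K₃)·σ₄ + Σ_P τ P ≤ charge(B₀)` (`K = G ∖ B₀`). -/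
theorem charge_ge_of_bounds' (hs : Simple M) {G B₀ : Finset α} {q : ℕ} (hG : G ⊆ gr M)
    (hrG : M.eRk (G : Set α) = (q : ℕ∞)) (hB : B₀ ∈ basesOf M G q) (hq : 2 ≤ q) (σ₃ σ₄ : ℚ) (τ : Finset α → ℚ)
    (h₃ : ∀ x ∈ G \ B₀, (fc M x B₀).card = 3 → σ₃ ≤ wTwo M G (insert x B₀) q / nb M G (insert x B₀) q)
    (h₄ : ∀ x ∈ G \ B₀, (fc M x B₀).card ≠ 3 → σ₄ ≤ wTwo M G (insert x B₀) q / nb M G (insert x B₀) q)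
    (hP : ∀ P ∈ (G \ B₀).powersetCard 2, τ P ≤ wTwo M G (B₀ ∪ P) q / nb M G (B₀ ∪ P) q) :
    (((G \ B₀).filter (fun x => (fc M x B₀).card = 3)).card : ℚ) * σ₃ +
      (((G \ B₀).card - ((G \ B₀).filter (fun x => (fc M x B₀).card = 3)).card : ℕ) : ℚ) * σ₄ +
      ∑ P ∈ (G \ B₀).powersetCard 2, τ P ≤ charge M G q B₀ := by
  set K := G \ B₀ with hK
  set K₃ := K.filter (fun x => (fc M x B₀).card = 3) with hK₃
  have hK₃K : K₃ ⊆ K := Finset.filter_subset _ _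
  have hsplit := Finset.sum_sdiff (f := fun x => wTwo M G (insert x B₀) q / nb M G (insert x B₀) q) hK₃K
  have hb₃ := Finset.card_nsmul_le_sum K₃ (fun x => wTwo M G (insert x B₀) q / nb M G (insert x B₀) q) σ₃
    (fun x hx => h₃ x (hK₃K hx) (Finset.mem_filter.1 hx).2)
  have hb₄ := Finset.card_nsmul_le_sum (K \ K₃) (fun x => wTwo M G (insert x B₀) q / nb M G (insert x B₀) q) σ₄
    (fun x hx => h₄ x (Finset.mem_sdiff.1 hx).1
      (fun h => (Finset.mem_sdiff.1 hx).2 (Finset.mem_filter.2 ⟨(Finset.mem_sdiff.1 hx).1, h⟩)))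
  have hbP := Finset.sum_le_sum hP
  rw [nsmul_eq_mul] at hb₃ hb₄
  rw [Finset.card_sdiff_of_subset hK₃K] at hb₄
  have hmain := charge_ge_singles_add_pairs hs hG hrG hB hq
  rw [← hsplit] at hmain
  linarith

/-- **The charge of `B₀` from the two layers with a uniform pair bound `τ`**:
`#K₃·σ₃ + (#K − #K₃)·σ₄ + C(#K, 2)·τ ≤ charge(B₀)`. -/
theorem charge_ge_of_bounds (hs : Simple M) {G B₀ : Finset α} {q : ℕ} (hG : G ⊆ gr M)
    (hrG : M.eRk (G : Set α) = (q : ℕ∞)) (hB : B₀ ∈ basesOf M G q) (hq : 2 ≤ q) (σ₃ σ₄ τ : ℚ)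
    (h₃ : ∀ x ∈ G \ B₀, (fc M x B₀).card = 3 → σ₃ ≤ wTwo M G (insert x B₀) q / nb M G (insert x B₀) q)
    (h₄ : ∀ x ∈ G \ B₀, (fc M x B₀).card ≠ 3 → σ₄ ≤ wTwo M G (insert x B₀) q / nb M G (insert x B₀) q)
    (hP : ∀ P ∈ (G \ B₀).powersetCard 2, τ ≤ wTwo M G (B₀ ∪ P) q / nb M G (B₀ ∪ P) q) :
    (((G \ B₀).filter (fun x => (fc M x B₀).card = 3)).card : ℚ) * σ₃ +
      (((G \ B₀).card - ((G \ B₀).filter (fun x => (fc M x B₀).card = 3)).card : ℕ) : ℚ) * σ₄ +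
      (((G \ B₀).card.choose 2 : ℕ) : ℚ) * τ ≤ charge M G q B₀ := by
  have h := charge_ge_of_bounds' hs hG hrG hB hq σ₃ σ₄ (fun _ => τ) h₃ h₄ hP
  rw [Finset.sum_const, Finset.card_powersetCard, nsmul_eq_mul] at h
  exact h

end PercRepro.GenQ
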